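import Summits.BirchSwinnertonDyer.BirchSwinnertonDyer.Theorems.EisensteinPrimesResidualIndexAssembly
import Literature.NumberTheory.EllipticCurves.GreenbergVatsal2000.NonPrimitiveDatumSelmerInvariants
import Literature.NumberTheory.EllipticCurves.Castella2018.AnticyclotomicSelmerDual
import HarnessLib

/-!
# The arithmetic of `stub_indexPlumbing` (v20.1, `≤` form): the mid-level `corank` identity + three one-sided
# dictionary inequalities ⟹ `λ(DSsub.X) + λ(DSquot.X) ≤ λ(𝔛^{Sf}_f) + ε`
# (cell `bsd-eis`, seat `bsd-line-x1-p1` LEAD g4; crux 2 `GoodLatticeBDPValue` stmt-BirchSwinnertonDyer-19032, line `halves`)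

HONEST FRAMING (cell `bsd-eis`, run/shared/lean/pub/bsd-eis/): pure bookkeeping (no definition, no named fact, no `sorry`, no
`Theses` import); nothing about any curve is asserted; BSD / IMC2 / KY Thm. 1.4.1 are proved for NO curve. Helper
`--supports stmt-BirchSwinnertonDyer-19032`; closes no registered stub by itself — it FIXES THE INTERFACE of the three inputs
the width seats deliver for `stub_indexPlumbing` of the registered skeleton `Cruxes/GoodLatticeBDPValue/Lines/halves.lean` (v20.1):

* `hsub  : λ(DSsub.X) ≤ corank_{ℤ_p} R((F/𝒪)(θsub))` — for `ω̃` the non-primitive (Greenberg) and strict groups over `K_∞`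
  coincide (w4 gen 3 `ResidualStrictEqUnramifiedChar`) and `λ = corank` for a dual datum (`finite_torsionBy_and_zpCorank_eq_lambdaInvariant`);
* `hquot : λ(DSquot.X) ≤ corank_{ℤ_p} R((F/𝒪)(θquot)) + p^c` — w8 `IndexPlumbingNrVsStrict.lambdaInvariant_le_zpCorank_grSelmer_add_pow`
  (`𝟙̃|_{D_v̄} = 𝟙`, a topological generator of `Gal(K̄_v̄/K_{∞,w̄})` modulo inertia, the representatives `τ_i`);
* `hf    : corank_{ℤ_p} R(E[p^∞]) ≤ λ(𝔛^{Sf}_f)` — Castella's `Sel_v̄^{Sf}(K_∞, E[p^∞])` versus the strict residual-type group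
  (unramified ⟹ locally trivial at the good places over `K_∞`) and `λ(𝔛^{Sf}_f) = corank Sel_v̄^{Sf}` (w6's (C1)–(C2));
* `hmid  : corank R(E[p^∞]) + ε = corank R((F/𝒪)(θsub)) + corank R((F/𝒪)(θquot)) + p^c` — this seat's
  `ResidualIndexAssembly.zpCorank_datumStrictSelmer_add_eq` (p645893), `R(A) = datumStrictSelmer (ker κ) A p (bdpData A p v̄) S₀`.

`lambda_add_le_of_index_inputs` is the resulting inequality (linear arithmetic); `lambda_add_eq_of_index_inputs` records the
identity form under the two-sided inputs, for the record. References: [KellerYin2024] Thm. 1.4.1 (iii), §1.4 and Rem. 1.2.2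
(arXiv:2402.12781v2); [Greenberg1989] §1; [Castella2018] Def. 2.2.
-/

-- D-0017: single-problem summit, the namespace repeats the problem name by design.
set_option linter.dupNamespace false
set_option autoImplicit false

noncomputable section

open scoped Classical

namespace Summit.BirchSwinnertonDyer.BirchSwinnertonDyer.Theorems.IndexPlumbingAssembly

open NumberField IsDedekindDomain Field
open Literature.NumberTheory.EllipticCurves Literature.NumberTheory.EllipticCurves.GreenbergSelmer
  Literature.NumberTheory.EllipticCurves.GreenbergVatsal2000 Literature.NumberTheory.GaloisRepresentations
  Literature.NumberTheory.EllipticCurves.IwasawaAlgebra Literature.NumberTheory.EllipticCurves.Castella2018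
  Literature.NumberTheory.EllipticCurves.KellerYin2024 Literature.NumberTheory.IwasawaTheory

variable {K : Type} [Field K] [NumberField K] {p : ℕ} [Fact p.Prime]

/-- **`stub_indexPlumbing` (v20.1) from its four inputs.** With `R(A) = datumStrictSelmer (ker κ) A p (bdpData A p v̄) S₀`:
`hmid` (the mid-level `corank` identity), `hsub` (`λ(DSsub.X) ≤ corank R(θsub)`), `hquot`
(`λ(DSquot.X) ≤ corank R(θquot) + p^c`), `hf` (`corank R(E[p^∞]) ≤ λ(𝔛^{Sf}_f)`) give
`λ(DSsub.X) + λ(DSquot.X) ≤ λ(𝔛^{Sf}_f) + ε`. [cite: KellerYin2024, Thm. 1.4.1 (iii) and §1.4 (arXiv:2402.12781v2 TeX L1087–1098, L1240–1260)] -/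
theorem lambda_add_le_of_index_inputs (E : WeierstrassCurve K) (κ : ZpExtension K p) (γ : absoluteGaloisGroup K)
    [Fact (κ.IsTopGenerator γ)] (vbar : HeightOneSpectrum (𝓞 K)) (S₀ : Set (HeightOneSpectrum (𝓞 K)))
    (θsub θquot : FramedGaloisRep K (padicCoeffIntegers (∅ : Set (PadicAlgCl p))) 1)
    (DSsub : DatumDualData κ γ (charModule ∅ θsub) (AcSelmer.bdpData (charModule ∅ θsub) p vbar) S₀)
    (DSquot : DatumDualData κ γ (charModule ∅ θquot) (AcSelmer.bdpData (charModule ∅ θquot) p vbar) S₀)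
    {c ε : ℕ}
    (hmid : zpCorank (datumStrictSelmer κ.kerSubgroup ↥(E.geomPrimaryTorsion p) p
        (AcSelmer.bdpData ↥(E.geomPrimaryTorsion p) p vbar) S₀) p + ε =
      zpCorank (datumStrictSelmer κ.kerSubgroup (charModule ∅ θsub) p
          (AcSelmer.bdpData (charModule ∅ θsub) p vbar) S₀) p +
        zpCorank (datumStrictSelmer κ.kerSubgroup (charModule ∅ θquot) p
          (AcSelmer.bdpData (charModule ∅ θquot) p vbar) S₀) p + p ^ c)
    (hsub : lambdaInvariant p DSsub.X ≤ zpCorank (datumStrictSelmer κ.kerSubgroup (charModule ∅ θsub) p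
        (AcSelmer.bdpData (charModule ∅ θsub) p vbar) S₀) p)
    (hquot : lambdaInvariant p DSquot.X ≤ zpCorank (datumStrictSelmer κ.kerSubgroup (charModule ∅ θquot) p
        (AcSelmer.bdpData (charModule ∅ θquot) p vbar) S₀) p + p ^ c)
    (hf : zpCorank (datumStrictSelmer κ.kerSubgroup ↥(E.geomPrimaryTorsion p) p
        (AcSelmer.bdpData ↥(E.geomPrimaryTorsion p) p vbar) S₀) p ≤ lambdaInvariant p (AcSelmer.XAc E p κ vbar S₀ γ)) :
    lambdaInvariant p DSsub.X + lambdaInvariant p DSquot.X ≤ lambdaInvariant p (AcSelmer.XAc E p κ vbar S₀ γ) + ε := by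
  omega

/-- **The identity form, for the record**: with the two-sided inputs (`=` in `hsub`, `hquot`, `hf`) the mid-level identity gives
KY Thm. 1.4.1 (iii) itself, `λ(𝔛^{Sf}_f) + ε = λ(DSsub.X) + λ(DSquot.X)`. [cite: KellerYin2024, Thm. 1.4.1 (iii) (arXiv:2402.12781v2 TeX L1087–1098)] -/
theorem lambda_add_eq_of_index_inputs (E : WeierstrassCurve K) (κ : ZpExtension K p) (γ : absoluteGaloisGroup K)
    [Fact (κ.IsTopGenerator γ)] (vbar : HeightOneSpectrum (𝓞 K)) (S₀ : Set (HeightOneSpectrum (𝓞 K)))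
    (θsub θquot : FramedGaloisRep K (padicCoeffIntegers (∅ : Set (PadicAlgCl p))) 1)
    (DSsub : DatumDualData κ γ (charModule ∅ θsub) (AcSelmer.bdpData (charModule ∅ θsub) p vbar) S₀)
    (DSquot : DatumDualData κ γ (charModule ∅ θquot) (AcSelmer.bdpData (charModule ∅ θquot) p vbar) S₀)
    {c ε : ℕ}
    (hmid : zpCorank (datumStrictSelmer κ.kerSubgroup ↥(E.geomPrimaryTorsion p) p
        (AcSelmer.bdpData ↥(E.geomPrimaryTorsion p) p vbar) S₀) p + ε =
      zpCorank (datumStrictSelmer κ.kerSubgroup (charModule ∅ θsub) p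
          (AcSelmer.bdpData (charModule ∅ θsub) p vbar) S₀) p +
        zpCorank (datumStrictSelmer κ.kerSubgroup (charModule ∅ θquot) p
          (AcSelmer.bdpData (charModule ∅ θquot) p vbar) S₀) p + p ^ c)
    (hsub : lambdaInvariant p DSsub.X = zpCorank (datumStrictSelmer κ.kerSubgroup (charModule ∅ θsub) p
        (AcSelmer.bdpData (charModule ∅ θsub) p vbar) S₀) p)
    (hquot : lambdaInvariant p DSquot.X = zpCorank (datumStrictSelmer κ.kerSubgroup (charModule ∅ θquot) p
        (AcSelmer.bdpData (charModule ∅ θquot) p vbar) S₀) p + p ^ c)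
    (hf : zpCorank (datumStrictSelmer κ.kerSubgroup ↥(E.geomPrimaryTorsion p) p
        (AcSelmer.bdpData ↥(E.geomPrimaryTorsion p) p vbar) S₀) p = lambdaInvariant p (AcSelmer.XAc E p κ vbar S₀ γ)) :
    lambdaInvariant p (AcSelmer.XAc E p κ vbar S₀ γ) + ε = lambdaInvariant p DSsub.X + lambdaInvariant p DSquot.X := by
  omega

end Summit.BirchSwinnertonDyer.BirchSwinnertonDyer.Theorems.IndexPlumbingAssembly

end
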